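import Summits.AtomisticToContinuum.HydrodynamicLimit.Theorems.OneSphereInfluenceHardCorePoincareDobrushinOscillation

/-!
# OneSphereInfluenceHardCorePoincareDobrushinInvariance — Abstract Dobrushin theory II: the sup
bound `|f − μ f| ≤ Φ f`, invariance and self-adjointness

This file is part 5/9 of the DobrushinDoor chain proving the crux
`OneSphereInfluence.HardCorePoincare` (stmt-AtomisticToContinuum-13619) sorry-free; the closing
theorem `hardCorePoincare_holds` and the full account are in
`OneSphereInfluenceHardCorePoincareDobrushin.lean` (part 9/9). decomp-a2c · lens-1 · g39.

CONTENTS. Model-free. The path lemma and `abs_sub_integral_le_Phi`; invariance in Bochner form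
`integral_siteOp`, `integral_scanOp`; self-adjointness `integral_mul_siteOp` (`⟨u, P_i w⟩ = ⟨P_i u,
P_i w⟩`) and its consequences for the random-scan operator; two real-variable lemmas (the `t`-trick
and the log-convex ratio lemma `ratio_le_of_logConvex`).
-/

open MeasureTheory ProbabilityTheory Set Function
open scoped ENNReal

noncomputable section

namespace Summit.AtomisticToContinuum.HydrodynamicLimit.Theorems.HardCorePoincareDobrushin.Abstract

variable {n : ℕ} {E : Type} [MeasurableSpace E]
variable {K : Fin (n + 1) → Kernel (Fin (n + 1) → E) E} [∀ i, IsMarkovKernel (K i)]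

/-! ### The path lemma `|f z' − f z| ≤ Φ f` and the sup-bound `|f z − μ f| ≤ Φ f` -/

/-- Hybrid configuration: coordinates `< k` from `z'`, the others from `z`. -/
def hybrid (z z' : Fin (n + 1) → E) (k : ℕ) : Fin (n + 1) → E :=
  fun l => if (l : ℕ) < k then z' l else z l

omit [MeasurableSpace E] in
/-- The hybrid configuration with no coordinates replaced is `z`. -/
theorem hybrid_zero (z z' : Fin (n + 1) → E) : hybrid z z' 0 = z :=
  funext fun l => by simp [hybrid]

omit [MeasurableSpace E] in
/-- The hybrid configuration with all `n + 1` coordinates replaced is `z'`. -/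
theorem hybrid_top (z z' : Fin (n + 1) → E) : hybrid z z' (n + 1) = z' :=
  funext fun l => by simp [hybrid, l.isLt]

omit [MeasurableSpace E] in
/-- Recursion for hybrids: step `k + 1` updates coordinate `k` of the `k`-th hybrid to `z' k`. -/
theorem hybrid_succ (z z' : Fin (n + 1) → E) {k : ℕ} (hk : k < n + 1) :
    hybrid z z' (k + 1) = update (hybrid z z' k) ⟨k, hk⟩ (z' ⟨k, hk⟩) := by
  funext l
  by_cases hl : l = ⟨k, hk⟩
  · subst hl; simp [hybrid]
  · rw [update_of_ne hl]
    have hne : (l : ℕ) ≠ k := fun h => hl (Fin.ext h)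
    simp only [hybrid]
    by_cases h1 : (l : ℕ) < k
    · rw [if_pos h1, if_pos (Nat.lt_succ_of_lt h1)]
    · have h2 : ¬ (l : ℕ) < k + 1 := by omega
      rw [if_neg h1, if_neg h2]

omit [MeasurableSpace E] in
/-- Updating coordinate `k` of the `k`-th hybrid with `z k` changes nothing. -/
theorem hybrid_same (z z' : Fin (n + 1) → E) {k : ℕ} (hk : k < n + 1) :
    update (hybrid z z' k) ⟨k, hk⟩ (z ⟨k, hk⟩) = hybrid z z' k := by
  funext l
  by_cases hl : l = ⟨k, hk⟩
  · subst hl; simp [hybrid]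
  · rw [update_of_ne hl]

omit [MeasurableSpace E] in
/-- Telescoping bound: `|f (hybrid z z' k) - f z|` is at most the sum of the first `k` coordinate oscillations. -/
theorem abs_sub_hybrid_le {f : (Fin (n + 1) → E) → ℝ} {M : ℝ} (hfM : ∀ z, |f z| ≤ M)
    (z z' : Fin (n + 1) → E) :
    ∀ k, k ≤ n + 1 → |f (hybrid z z' k) - f z| ≤
      ∑ l ∈ Finset.range k, (if h : l < n + 1 then osc ⟨l, h⟩ f else 0) := by
  intro k
  induction k with
  | zero => intro _; simp [hybrid_zero]
  | succ k ih =>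
      intro hk
      have hk' : k < n + 1 := hk
      rw [Finset.sum_range_succ, dif_pos hk']
      calc |f (hybrid z z' (k + 1)) - f z|
          ≤ |f (hybrid z z' (k + 1)) - f (hybrid z z' k)| + |f (hybrid z z' k) - f z| :=
            abs_sub_le _ _ _
        _ ≤ osc ⟨k, hk'⟩ f + ∑ l ∈ Finset.range k, (if h : l < n + 1 then osc ⟨l, h⟩ f else 0) := by
            refine add_le_add ?_ (ih hk'.le)
            have h := abs_sub_le_osc hfM ⟨k, hk'⟩ (hybrid z z' k) (z' ⟨k, hk'⟩) (z ⟨k, hk'⟩)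
            rw [hybrid_same z z' hk', ← hybrid_succ z z' hk'] at h
            exact h
        _ = _ := add_comm _ _

omit [MeasurableSpace E] in
/-- Any two values of a bounded `f` differ by at most the total oscillation `Phi f`. -/
theorem abs_sub_le_Phi {f : (Fin (n + 1) → E) → ℝ} {M : ℝ} (hfM : ∀ z, |f z| ≤ M)
    (z z' : Fin (n + 1) → E) : |f z' - f z| ≤ Phi f := by
  have h := abs_sub_hybrid_le hfM z z' (n + 1) le_rfl
  rw [hybrid_top] at h
  refine h.trans_eq ?_
  unfold Phi
  rw [← Fin.sum_univ_eq_sum_range (fun l => if h : l < n + 1 then osc ⟨l, h⟩ f else 0) (n + 1)]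
  exact Finset.sum_congr rfl fun j _ => by rw [dif_pos j.isLt]

/-- A bounded measurable `f` deviates from its mean under a probability measure by at most `Phi f`. -/
theorem abs_sub_integral_le_Phi {μ : Measure (Fin (n + 1) → E)} [IsProbabilityMeasure μ]
    {f : (Fin (n + 1) → E) → ℝ} (hf : Measurable f) {M : ℝ} (hfM : ∀ z, |f z| ≤ M)
    (z : Fin (n + 1) → E) : |f z - ∫ x, f x ∂μ| ≤ Phi f := by
  have hfi : Integrable f μ := integrable_of_bounded hf hfM
  have h1 : f z - ∫ x, f x ∂μ = ∫ x, (f z - f x) ∂μ := by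
    rw [integral_sub (integrable_const _) hfi, integral_const, probReal_univ, one_smul]
  rw [h1]
  have h := norm_integral_le_of_norm_le_const (μ := μ) (f := fun x => f z - f x) (C := Phi f)
    (Filter.Eventually.of_forall fun x => by
      rw [Real.norm_eq_abs]; exact abs_sub_le_Phi hfM x z)
  rw [Real.norm_eq_abs, probReal_univ, mul_one] at h
  exact h


/-! ### Invariance in Bochner form and self-adjointness of the one-site operators -/

section Invariance

variable {μ : Measure (Fin (n + 1) → E)} [IsProbabilityMeasure μ]

/-- Under the invariance identity for the kernels, `siteOp K i` preserves the `μ`-integral of bounded measurable functions. -/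
theorem integral_siteOp
    (hinv : ∀ i (F : (Fin (n + 1) → E) → ℝ≥0∞), Measurable F →
      ∫⁻ z, ∫⁻ y, F (update z i y) ∂(K i z) ∂μ = ∫⁻ z, F z ∂μ)
    {f : (Fin (n + 1) → E) → ℝ} (hf : Measurable f) {M : ℝ} (hfM : ∀ z, |f z| ≤ M)
    (i : Fin (n + 1)) : ∫ z, siteOp K i f z ∂μ = ∫ z, f z ∂μ := by
  have hM : ∀ z, 0 ≤ f z + M := fun z => by linarith [(abs_le.1 (hfM z)).1]
  have hFm : Measurable fun z => ENNReal.ofReal (f z + M) := (hf.add_const M).ennreal_ofReal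
  have key := hinv i _ hFm
  -- inner integrals
  have hinner : ∀ z, ∫⁻ y, ENNReal.ofReal (f (update z i y) + M) ∂(K i z) =
      ENNReal.ofReal (siteOp K i f z + M) := by
    intro z
    have hI : Integrable (fun y => f (update z i y) + M) (K i z) :=
      (integrable_site K hf hfM i z).add (integrable_const M)
    rw [← ofReal_integral_eq_lintegral_ofReal hI (Filter.Eventually.of_forall fun y => hM _),
      integral_add (integrable_site K hf hfM i z) (integrable_const M), integral_const,
      probReal_univ, one_smul]
    rfl
  simp_rw [hinner] at key
  have hS : Integrable (fun z => siteOp K i f z + M) μ :=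
    (integrable_of_bounded (measurable_siteOp K hf i) (abs_siteOp_le K hfM i)).add
      (integrable_const M)
  have hS0 : ∀ z, 0 ≤ siteOp K i f z + M := fun z => by
    linarith [(abs_le.1 (abs_siteOp_le K hfM i z)).1]
  have hI2 : Integrable (fun z => f z + M) μ := (integrable_of_bounded hf hfM).add (integrable_const M)
  rw [← ofReal_integral_eq_lintegral_ofReal hS (Filter.Eventually.of_forall hS0),
    ← ofReal_integral_eq_lintegral_ofReal hI2 (Filter.Eventually.of_forall hM),
    ENNReal.ofReal_eq_ofReal_iff (integral_nonneg hS0) (integral_nonneg hM),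
    integral_add (integrable_of_bounded (measurable_siteOp K hf i) (abs_siteOp_le K hfM i))
      (integrable_const M),
    integral_add (integrable_of_bounded hf hfM) (integrable_const M)] at key
  linarith

/-- Under the invariance identity for the kernels, `scanOp K` preserves the `μ`-integral of bounded measurable functions. -/
theorem integral_scanOp
    (hinv : ∀ i (F : (Fin (n + 1) → E) → ℝ≥0∞), Measurable F →
      ∫⁻ z, ∫⁻ y, F (update z i y) ∂(K i z) ∂μ = ∫⁻ z, F z ∂μ)
    {f : (Fin (n + 1) → E) → ℝ} (hf : Measurable f) {M : ℝ} (hfM : ∀ z, |f z| ≤ M) :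
    ∫ z, scanOp K f z ∂μ = ∫ z, f z ∂μ := by
  unfold scanOp
  rw [integral_const_mul, integral_finsetSum _ fun i _ =>
    integrable_of_bounded (measurable_siteOp K hf i) (abs_siteOp_le K hfM i)]
  simp_rw [integral_siteOp hinv hf hfM]
  rw [Finset.sum_const, Finset.card_univ, Fintype.card_fin, nsmul_eq_mul]
  push_cast
  have : (0 : ℝ) < (n : ℝ) + 1 := by positivity
  field_simp

/-- `⟨u, P_i w⟩ = ⟨P_i u, P_i w⟩`. -/
theorem integral_mul_siteOp
    (hloc : ∀ i (z : Fin (n + 1) → E) (y : E), K i (update z i y) = K i z)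
    (hinv : ∀ i (F : (Fin (n + 1) → E) → ℝ≥0∞), Measurable F →
      ∫⁻ z, ∫⁻ y, F (update z i y) ∂(K i z) ∂μ = ∫⁻ z, F z ∂μ)
    {u w : (Fin (n + 1) → E) → ℝ} (hu : Measurable u) (hw : Measurable w) {Mu Mw : ℝ}
    (huM : ∀ z, |u z| ≤ Mu) (hwM : ∀ z, |w z| ≤ Mw) (i : Fin (n + 1)) :
    ∫ z, u z * siteOp K i w z ∂μ = ∫ z, siteOp K i u z * siteOp K i w z ∂μ := by
  -- apply invariance to `h := u · P_i w`
  set h : (Fin (n + 1) → E) → ℝ := fun z => u z * siteOp K i w z with hh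
  have hhm : Measurable h := hu.mul (measurable_siteOp K hw i)
  have hhM : ∀ z, |h z| ≤ Mu * Mw := fun z => by
    rw [hh]; dsimp only; rw [abs_mul]
    exact mul_le_mul (huM z) (abs_siteOp_le K hwM i z) (abs_nonneg _)
      ((abs_nonneg _).trans (huM z))
  have key := integral_siteOp hinv hhm hhM i
  have hP : ∀ z, siteOp K i h z = siteOp K i u z * siteOp K i w z := by
    intro z
    unfold siteOp
    have : ∀ y, h (update z i y) = u (update z i y) * siteOp K i w z := fun y => by
      rw [hh]; dsimp only; rw [siteOp_update hloc]
    simp_rw [this]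
    rw [integral_mul_const]
    rfl
  simp_rw [hP] at key
  rw [key]

/-- Symmetry `⟨u, P_i w⟩ = ⟨P_i u, w⟩`. -/
theorem integral_mul_siteOp_comm
    (hloc : ∀ i (z : Fin (n + 1) → E) (y : E), K i (update z i y) = K i z)
    (hinv : ∀ i (F : (Fin (n + 1) → E) → ℝ≥0∞), Measurable F →
      ∫⁻ z, ∫⁻ y, F (update z i y) ∂(K i z) ∂μ = ∫⁻ z, F z ∂μ)
    {u w : (Fin (n + 1) → E) → ℝ} (hu : Measurable u) (hw : Measurable w) {Mu Mw : ℝ}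
    (huM : ∀ z, |u z| ≤ Mu) (hwM : ∀ z, |w z| ≤ Mw) (i : Fin (n + 1)) :
    ∫ z, u z * siteOp K i w z ∂μ = ∫ z, siteOp K i u z * w z ∂μ := by
  rw [integral_mul_siteOp hloc hinv hu hw huM hwM i]
  have := integral_mul_siteOp hloc hinv hw hu hwM huM i (K := K) (μ := μ)
  simp_rw [mul_comm (w _)] at this
  rw [this]
  simp_rw [mul_comm]

/-- `⟨u, T w⟩ = ⟨T u, w⟩`. -/
theorem integral_mul_scanOp_comm
    (hloc : ∀ i (z : Fin (n + 1) → E) (y : E), K i (update z i y) = K i z)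
    (hinv : ∀ i (F : (Fin (n + 1) → E) → ℝ≥0∞), Measurable F →
      ∫⁻ z, ∫⁻ y, F (update z i y) ∂(K i z) ∂μ = ∫⁻ z, F z ∂μ)
    {u w : (Fin (n + 1) → E) → ℝ} (hu : Measurable u) (hw : Measurable w) {Mu Mw : ℝ}
    (huM : ∀ z, |u z| ≤ Mu) (hwM : ∀ z, |w z| ≤ Mw) :
    ∫ z, u z * scanOp K w z ∂μ = ∫ z, scanOp K u z * w z ∂μ := by
  unfold scanOp
  have h1 : ∀ z, u z * (((n : ℝ) + 1)⁻¹ * ∑ i, siteOp K i w z) =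
      ((n : ℝ) + 1)⁻¹ * ∑ i, u z * siteOp K i w z := fun z => by
    rw [← mul_assoc, mul_comm (u z), mul_assoc, Finset.mul_sum]
  have h2 : ∀ z, (((n : ℝ) + 1)⁻¹ * ∑ i, siteOp K i u z) * w z =
      ((n : ℝ) + 1)⁻¹ * ∑ i, siteOp K i u z * w z := fun z => by
    rw [mul_assoc, Finset.sum_mul]
  simp_rw [h1, h2]
  rw [integral_const_mul, integral_const_mul,
    integral_finsetSum _ fun i _ => ?_, integral_finsetSum _ fun i _ => ?_]
  · simp_rw [integral_mul_siteOp_comm hloc hinv hu hw huM hwM]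
  · exact integrable_of_bounded ((measurable_siteOp K hu i).mul hw) (M := Mu * Mw) fun z => by
      rw [abs_mul]
      exact mul_le_mul (abs_siteOp_le K huM i z) (hwM z) (abs_nonneg _)
        ((abs_nonneg _).trans (abs_siteOp_le K huM i z))
  · exact integrable_of_bounded (hu.mul (measurable_siteOp K hw i)) (M := Mu * Mw) fun z => by
      rw [abs_mul]
      exact mul_le_mul (huM z) (abs_siteOp_le K hwM i z) (abs_nonneg _)
        ((abs_nonneg _).trans (huM z))

/-- `⟨u, T u⟩ = (n+1)⁻¹ Σ_i ‖P_i u‖²`. -/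
theorem integral_mul_scanOp_self
    (hloc : ∀ i (z : Fin (n + 1) → E) (y : E), K i (update z i y) = K i z)
    (hinv : ∀ i (F : (Fin (n + 1) → E) → ℝ≥0∞), Measurable F →
      ∫⁻ z, ∫⁻ y, F (update z i y) ∂(K i z) ∂μ = ∫⁻ z, F z ∂μ)
    {u : (Fin (n + 1) → E) → ℝ} (hu : Measurable u) {Mu : ℝ} (huM : ∀ z, |u z| ≤ Mu) :
    ∫ z, u z * scanOp K u z ∂μ = ((n : ℝ) + 1)⁻¹ * ∑ i, ∫ z, (siteOp K i u z) ^ 2 ∂μ := by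
  unfold scanOp
  have h1 : ∀ z, u z * (((n : ℝ) + 1)⁻¹ * ∑ i, siteOp K i u z) =
      ((n : ℝ) + 1)⁻¹ * ∑ i, u z * siteOp K i u z := fun z => by
    rw [← mul_assoc, mul_comm (u z), mul_assoc, Finset.mul_sum]
  simp_rw [h1]
  rw [integral_const_mul, integral_finsetSum _ fun i _ => ?_]
  · congr 1
    refine Finset.sum_congr rfl fun i _ => ?_
    rw [integral_mul_siteOp hloc hinv hu hu huM huM i]
    simp_rw [pow_two]
  · exact integrable_of_bounded (hu.mul (measurable_siteOp K hu i)) (M := Mu * Mu) fun z => by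
      rw [abs_mul]
      exact mul_le_mul (huM z) (abs_siteOp_le K huM i z) (abs_nonneg _)
        ((abs_nonneg _).trans (huM z))

end Invariance


/-! ### Two real-variable lemmas: the `t`-trick and the log-convex ratio lemma -/

/-- Weighted AM–GM: `2ab ≤ t a² + t⁻¹ b²` for `t > 0`. -/
theorem two_mul_le_of_sq {a b t : ℝ} (ht : 0 < t) : 2 * (a * b) ≤ t * a ^ 2 + t⁻¹ * b ^ 2 := by
  have ht0 : t ≠ 0 := ht.ne'
  rw [← sub_nonneg]
  have : t * a ^ 2 + t⁻¹ * b ^ 2 - 2 * (a * b) = t⁻¹ * (t * a - b) ^ 2 := by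
    field_simp; ring
  rw [this]; positivity

/-- If `2x ≤ t a + t⁻¹ b` for every `t > 0` (with `x, a, b ≥ 0`) then `x² ≤ a b`. -/
theorem sq_le_mul_of_forall {x a b : ℝ} (hx : 0 ≤ x) (ha : 0 ≤ a) (hb : 0 ≤ b)
    (h : ∀ t : ℝ, 0 < t → 2 * x ≤ t * a + t⁻¹ * b) : x ^ 2 ≤ a * b := by
  rcases hx.eq_or_lt with hx0 | hx'
  · rw [← hx0]; simpa using mul_nonneg ha hb
  rcases ha.eq_or_lt with ha0 | ha'
  · exfalso
    have h1 := h (b / x + 1) (by positivity)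
    rw [← ha0, mul_zero, zero_add] at h1
    have h2 : (b / x + 1)⁻¹ * b ≤ x := by
      rw [inv_mul_le_iff₀ (by positivity)]
      have : (b / x + 1) * x = b + x := by field_simp
      linarith
    linarith
  · have h1 := h (x / a) (by positivity)
    have e1 : x / a * a = x := by field_simp
    have e2 : (x / a)⁻¹ * b = a * b / x := by field_simp
    rw [e1, e2] at h1
    have h2 : x ≤ a * b / x := by linarith
    rw [le_div_iff₀ hx'] at h2
    nlinarith

/-- A nonnegative log-convex sequence dominated by `B ρ^k` satisfies `v 1 ≤ ρ v 0`. -/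
theorem ratio_le_of_logConvex {v : ℕ → ℝ} (hv0 : ∀ k, 0 ≤ v k)
    (hlc : ∀ k, v (k + 1) ^ 2 ≤ v k * v (k + 2)) {B ρ : ℝ} (hρ : 0 ≤ ρ)
    (hB : ∀ k, v k ≤ B * ρ ^ k) : v 1 ≤ ρ * v 0 := by
  by_contra H
  rw [not_le] at H
  have hv1 : 0 < v 1 := (mul_nonneg hρ (hv0 0)).trans_lt H
  have hv0' : 0 < v 0 := by
    rcases (hv0 0).eq_or_lt with h | h
    · exfalso
      have := hlc 0
      rw [← h, zero_mul] at this
      nlinarith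
    · exact h
  set q := v 1 / v 0 with hq
  have hqρ : ρ < q := by rw [hq, lt_div_iff₀ hv0']; exact H
  have hq0 : 0 < q := hρ.trans_lt hqρ
  have step : ∀ k, q * v k ≤ v (k + 1) ∧ 0 < v k := by
    intro k
    induction k with
    | zero => exact ⟨by rw [hq, div_mul_cancel₀ _ hv0'.ne'], hv0'⟩
    | succ k ih =>
        obtain ⟨h1, h2⟩ := ih
        have h3 : 0 < v (k + 1) := (mul_pos hq0 h2).trans_le h1
        refine ⟨?_, h3⟩
        have h4 := hlc k
        have h5 : v k * (q * v (k + 1)) ≤ v k * v (k + 2) := by nlinarith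
        exact le_of_mul_le_mul_left h5 h2
  have geom : ∀ k, q ^ k * v 0 ≤ v k := by
    intro k
    induction k with
    | zero => simp
    | succ k ih =>
        calc q ^ (k + 1) * v 0 = q * (q ^ k * v 0) := by ring
          _ ≤ q * v k := mul_le_mul_of_nonneg_left ih hq0.le
          _ ≤ v (k + 1) := (step k).1
  rcases hρ.eq_or_lt with h | hρ'
  · have h1 := (geom 1).trans (hB 1)
    rw [← h] at h1
    simp only [pow_one, mul_zero] at h1
    nlinarith [mul_pos hq0 hv0']
  · have hr : 1 < q / ρ := (one_lt_div hρ').2 hqρ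
    have hbd : ∀ k, (q / ρ) ^ k ≤ B / v 0 := by
      intro k
      have h1 := (geom k).trans (hB k)
      rw [div_pow, div_le_div_iff₀ (pow_pos hρ' k) hv0']
      linarith
    obtain ⟨k, hk⟩ :=
      ((tendsto_pow_atTop_atTop_of_one_lt hr).eventually_gt_atTop (B / v 0)).exists
    exact absurd (hbd k) (not_le.2 hk)

end Summit.AtomisticToContinuum.HydrodynamicLimit.Theorems.HardCorePoincareDobrushin.Abstract

end
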